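import Summits.ValiantsHypothesis.ValiantsHypothesis.Theorems.KPlusLogSqLawTropicalBTorusStaircase
import Summits.ValiantsHypothesis.ValiantsHypothesis.Theorems.KPlusLogSqLawTropicalBNoFreePolygon
import Summits.ValiantsHypothesis.ValiantsHypothesis.Theorems.KPlusLogSqLawTropicalCycleMonotone

/-!
# Route «KPlusLogSqLaw», crux `TropicalB` (stmt-ValiantsHypothesis-19771) — A SINGLE-TOKEN ACTIVATION DEVIATES ALONG ONE EXCHANGE CYCLE
# THROUGH ITS TOKEN COLUMN, and ONE DOCKED PIECE BETWEEN TWO TRIPLE COLUMNS IS IN DEFICIT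

HONEST FRAMING.  Helper toward the registered stubs `stub_tropThin` / `stub_tropFat` of `Cruxes/TropicalB/Lines/birth.lean` (crux
`Summit.ValiantsHypothesis.ValiantsHypothesis.Theses.KPlusLogSqLaw.TropicalB`, item stmt-ValiantsHypothesis-19771, route KPlusLogSqLaw;
cell `pub-symmetroid`, seat val-sym-trop-p5 g26, refuter-adjacent lane, 2026-08-29; `--supports … --as helper`).  STRUCTURE laws about
unique optima (`IsDominant`) of an ARBITRARY dominance design; nothing here bounds `TropicalB`, and nothing bears on `WeakLifting`,
DoorA26 / DoorA34, `MatrixDescartes` (stmt-ValiantsHypothesis-18050) or VP ≠ VNP.  Sequel: `…TropicalBSingleContact` (the single-contact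
law C2 of memo HOME/val-sym-trop-p5/g25/CONTACT-LAWS-g25.md, assembled from this file and the torus staircase lemma).

§4 `sameCycle_token` — **THE DEVIATION OF A SINGLE-TOKEN ACTIVATION IS ONE CYCLE.**  `B` (unique optimum at `θB`) and `P` (at `θP`),
`P` CONCENTRATED over `B` (the classes of `P` carry the exponents of `B` off one column `eP`, where the exponent goes up).  Then every
column at which `P` deviates from `B` (in row or class) lies on the `σ_B⁻¹σ_P`-cycle of `eP`: an orbit of deviating columns avoiding `eP`
would be an invariant block on which two unique optima differ with EQUAL exponent mass, against cyclewise monotonicity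
(`sum_d_lt_of_isDominant_invariant`, …TropicalCycleMonotone; the slope order `θB < θP` follows from the slope increase,
`theta_lt_of_slope_lt`).  Hence torus coordinates: from any deviating base column `a`, `t ↦ (σ_B⁻¹σ_P)^t a` enumerates exactly the
deviating columns below the period (`coord_dev`, `coord_exists`).  (Located on the cell's kernel cubes L = 3..6, HOME/val-sym-trop-p5/g26/
exp/triple_check.py: 0/166 concentrated activations with a second component.)
§5 `piece_pos` — **ONE PIECE IS IN DEFICIT.**  With `Q` a second single-token activation over `B` and `col`, `colQ` the two coordinate
maps from a common base column (`col 0 = colQ 0`): for a box `(tU,tW) × (sW,sU)` of the torus whose corners `U = col tU = colQ sU`,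
`W = col tW = colQ sW` are columns at which `P ≠ Q`, not the whole torus, and which contains no common column, the piece
«`P` on `col '' [tU,tW)`, `Q` on `colQ '' [sW,sU)`, `B` elsewhere» is a present term by the docking lemma (`Docking.docking` over `Bool`),
distinct from `B, P, Q`, so the re-assembly deficit (`Deficit.reassembly_deficit`) makes its PIECE FUNCTIONAL
`g = Σ_A (v_P − v_B) + Σ_D (v_Q − v_B) − [eP ∈ A](V_P − V_B) − [eQ ∈ D](V_Q − V_B)` positive.  This is the base case of the torus staircase
induction; the whole torus has `g = 0`.

[this cell; folklore ingredients (exchange cycles, lower hulls)]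
-/

set_option linter.dupNamespace false
set_option autoImplicit false

namespace Summit.ValiantsHypothesis.ValiantsHypothesis.Theorems.KPlusLogSqLaw

namespace SingleContact

/-! ## 4. Single-token activations: slope order, and the deviation set is ONE cycle through the token column -/

section Orbit

open Summit.ValiantsHypothesis.ValiantsHypothesis.Theorems.MatrixDescartes.Negative
open Summit.ValiantsHypothesis.ValiantsHypothesis.Theorems.LacunarySymmetroidMatrixDescartes
open Finset

variable {m K : ℕ} (d : Fin K → ℕ) (v ε : Fin m → Fin m → Fin K → ℤ)

/-- unique optima are ordered in the slope parameter as their slopes are. [folklore: convexity of the envelope] -/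
theorem theta_lt_of_slope_lt {θB θP : ℤ} {B P : Equiv.Perm (Fin m) × (Fin m → Fin K)}
    (hB : IsDominant d v ε θB B) (hP : IsDominant d v ε θP P)
    (hs : TropicalCensus.slope d B < TropicalCensus.slope d P) : θB < θP := by
  have hne : B ≠ P := fun h => by rw [h] at hs; exact lt_irrefl _ hs
  have h1 := hB.2 P (Ne.symm hne) hP.1
  have h2 := hP.2 B hne hB.1
  rw [TropicalCensus.tropWeight_eq_slope_sub, TropicalCensus.tropWeight_eq_slope_sub] at h1 h2
  by_contra hle
  push Not at hle
  nlinarith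

/-- a single-token activation raises the slope. [elementary] -/
theorem slope_lt_of_concentrated {B P : Equiv.Perm (Fin m) × (Fin m → Fin K)} (eP : Fin m)
    (hcP : ∀ i, i ≠ eP → d (P.2 i) = d (B.2 i)) (hδP : d (B.2 eP) < d (P.2 eP)) :
    TropicalCensus.slope d B < TropicalCensus.slope d P := by
  rw [Docking.slope_eq_of_concentrated d B P eP hcP]
  have : ((d (B.2 eP) : ℕ) : ℤ) < d (P.2 eP) := by exact_mod_cast hδP
  linarith

/-- **THE DEVIATION OF A SINGLE-TOKEN ACTIVATION IS ONE EXCHANGE CYCLE THROUGH THE TOKEN COLUMN.**  If `B` (at `θB`) and `P` (at `θP`)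
are unique optima and the classes of `P` carry the exponents of `B` off one column `eP`, where the exponent goes up, then every column at
which `P` deviates from `B` (in row or class) lies on the `σ_B⁻¹σ_P`-cycle of `eP`: an orbit avoiding `eP` would be an invariant block of
columns on which the two optima differ with EQUAL exponent mass, against cyclewise monotonicity (`sum_d_lt_of_isDominant_invariant`).
[this cell; folklore ingredients] -/
theorem sameCycle_token {θB θP : ℤ} {B P : Equiv.Perm (Fin m) × (Fin m → Fin K)}
    (hB : IsDominant d v ε θB B) (hP : IsDominant d v ε θP P) (eP : Fin m)
    (hcP : ∀ i, i ≠ eP → d (P.2 i) = d (B.2 i)) (hδP : d (B.2 eP) < d (P.2 eP))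
    {c : Fin m} (hc : ¬ (P.1 c = B.1 c ∧ P.2 c = B.2 c)) : (B.1⁻¹ * P.1).SameCycle c eP := by
  classical
  have hθ := theta_lt_of_slope_lt d v ε hB hP (slope_lt_of_concentrated d eP hcP hδP)
  by_contra hne
  obtain ⟨σB, lB⟩ := B
  obtain ⟨σP, lP⟩ := P
  dsimp only at hcP hδP hc hne hB hP
  set T : Finset (Fin m) := univ.filter fun x => (σB⁻¹ * σP).SameCycle c x with hTdef
  have hT : ∀ b, (σB⁻¹ * σP) b ∈ T ↔ b ∈ T := by
    intro b
    simp only [hTdef, mem_filter, mem_univ, true_and]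
    exact Equiv.Perm.sameCycle_apply_right
  have hcT : c ∈ T := by
    simp only [hTdef, mem_filter, mem_univ, true_and]
    exact Equiv.Perm.SameCycle.refl _ _
  have hdiff : ∃ b ∈ T, σB b ≠ σP b ∨ lB b ≠ lP b := by
    refine ⟨c, hcT, ?_⟩
    by_contra h
    push Not at h
    exact hc ⟨h.1.symm, h.2.symm⟩
  have key := sum_d_lt_of_isDominant_invariant d v ε hθ hB hP T hT hdiff
  have heq : ∑ b ∈ T, (d (lB b) : ℤ) = ∑ b ∈ T, (d (lP b) : ℤ) := by
    refine sum_congr rfl fun b hb => ?_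
    have hbe : b ≠ eP := by
      rintro rfl
      simp only [hTdef, mem_filter, mem_univ, true_and] at hb
      exact hne hb
    rw [hcP b hbe]
  rw [heq] at key
  exact lt_irrefl _ key

/-- the deviation set is stable under the quotient `σ_B⁻¹σ_P`. [elementary] -/
theorem dev_step {B P : Equiv.Perm (Fin m) × (Fin m → Fin K)} {c : Fin m} (hc : ¬ (P.1 c = B.1 c ∧ P.2 c = B.2 c)) :
    ¬ (P.1 (B.1.symm (P.1 c)) = B.1 (B.1.symm (P.1 c)) ∧ P.2 (B.1.symm (P.1 c)) = B.2 (B.1.symm (P.1 c))) := by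
  by_cases h1 : P.1 c = B.1 c
  · have : B.1.symm (P.1 c) = c := by rw [h1]; simp
    rw [this]; exact hc
  · intro h
    have h2 : B.1 (B.1.symm (P.1 c)) = P.1 c := by simp
    have h3 : B.1.symm (P.1 c) = c := P.1.injective (h.1.trans h2)
    rw [h3] at h2
    exact h1 h2.symm

/-- the token column deviates. [elementary] -/
theorem dev_token {B P : Equiv.Perm (Fin m) × (Fin m → Fin K)} (eP : Fin m) (hδP : d (B.2 eP) < d (P.2 eP)) :
    ¬ (P.1 eP = B.1 eP ∧ P.2 eP = B.2 eP) := by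
  intro h
  rw [h.2] at hδP
  exact lt_irrefl _ hδP

/-- torus coordinates of a single-token activation: with a base column `a` deviating, `t ↦ (σ_B⁻¹σ_P)^t a` runs through deviating columns,
and every deviating column has a coordinate below the period. [this cell] -/
theorem coord_dev {B P : Equiv.Perm (Fin m) × (Fin m → Fin K)} {a : Fin m} (ha : ¬ (P.1 a = B.1 a ∧ P.2 a = B.2 a)) :
    ∀ t, ¬ (P.1 (((B.1⁻¹ * P.1) ^ t) a) = B.1 (((B.1⁻¹ * P.1) ^ t) a) ∧ P.2 (((B.1⁻¹ * P.1) ^ t) a) = B.2 (((B.1⁻¹ * P.1) ^ t) a)) := by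
  intro t
  induction t with
  | zero => simpa using ha
  | succ t ih =>
    rw [pow_succ_apply]
    exact dev_step ih

/-- every deviating column of a single-token activation has a torus coordinate below the period (from any deviating base column). [this cell] -/
theorem coord_exists {θB θP : ℤ} {B P : Equiv.Perm (Fin m) × (Fin m → Fin K)}
    (hB : IsDominant d v ε θB B) (hP : IsDominant d v ε θP P) (eP : Fin m)
    (hcP : ∀ i, i ≠ eP → d (P.2 i) = d (B.2 i)) (hδP : d (B.2 eP) < d (P.2 eP))
    {a c : Fin m} (ha : ¬ (P.1 a = B.1 a ∧ P.2 a = B.2 a)) (hc : ¬ (P.1 c = B.1 c ∧ P.2 c = B.2 c)) :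
    ∃ t, t < Function.minimalPeriod (B.1⁻¹ * P.1) a ∧ ((B.1⁻¹ * P.1) ^ t) a = c :=
  exists_coord _ _ ((sameCycle_token d v ε hB hP eP hcP hδP ha).trans (sameCycle_token d v ε hB hP eP hcP hδP hc).symm)

end Orbit

/-! ## 5. One piece: a docked (X-run, Y-run) pair between two star corners has POSITIVE functional -/

section Piece

open Summit.ValiantsHypothesis.ValiantsHypothesis.Theorems.MatrixDescartes.Negative
open Summit.ValiantsHypothesis.ValiantsHypothesis.Theorems.LacunarySymmetroidMatrixDescartes
open Finset

variable {m K : ℕ} (d : Fin K → ℕ) (v ε : Fin m → Fin m → Fin K → ℤ)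

/-- **ONE PIECE IS IN DEFICIT.**  `B, P, Q` unique optima, `P` and `Q` single-token activations over `B` (token columns `eP`, `eQ`);
`col`, `colQ` torus coordinates along the two exchange cycles from a common base column (`col 0 = colQ 0`), with periods `NP`, `NQ`.
For a box `(tU, tW) × (sW, sU)` between corners `U = col tU = colQ sU` and `W = col tW = colQ sW` at which `P ≠ Q`, not the whole
torus, containing no common column, the piece «`P` on `col '' [tU, tW)`, `Q` on `colQ '' [sW, sU)`, `B` elsewhere» is a present term
(docking lemma) other than `B, P, Q`, so by the re-assembly deficit its valuation gain strictly exceeds the gains of the tokens it holds: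
the piece functional `g` is positive. [this cell] -/
theorem piece_pos {θB θP θQ : ℤ} {B P Q : Equiv.Perm (Fin m) × (Fin m → Fin K)}
    (hB : IsDominant d v ε θB B) (hP : IsDominant d v ε θP P) (hQ : IsDominant d v ε θQ Q) (eP eQ : Fin m)
    (hcP : ∀ i, i ≠ eP → d (P.2 i) = d (B.2 i)) (hcQ : ∀ i, i ≠ eQ → d (Q.2 i) = d (B.2 i))
    (hδP : d (B.2 eP) < d (P.2 eP)) (hδQ : d (B.2 eQ) < d (Q.2 eQ))
    (col colQ : ℕ → Fin m) (NP NQ : ℕ)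
    (hcs : ∀ t, B.1.symm (P.1 (col t)) = col (t + 1)) (hqs : ∀ s, B.1.symm (Q.1 (colQ s)) = colQ (s + 1))
    (hci : ∀ t t', t < NP → t' < NP → col t = col t' → t = t') (hqi : ∀ s s', s < NQ → s' < NQ → colQ s = colQ s' → s = s')
    (hcN : col NP = col 0) (hqN : colQ NQ = colQ 0) (h00 : col 0 = colQ 0)
    (hcdev : ∀ t, ¬ (P.1 (col t) = B.1 (col t) ∧ P.2 (col t) = B.2 (col t)))
    {tU sU tW sW : ℕ} (htUW : tU < tW) (htW : tW ≤ NP) (hsWU : sW < sU) (hsU : sU ≤ NQ)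
    (hU : col tU = colQ sU) (hW : col tW = colQ sW)
    (hUstar : ¬ (P.1 (col tU) = Q.1 (col tU) ∧ P.2 (col tU) = Q.2 (col tU)))
    (hWstar : ¬ (P.1 (col tW) = Q.1 (col tW) ∧ P.2 (col tW) = Q.2 (col tW)))
    (hni : ¬ (tU = 0 ∧ tW = NP))
    (hbox : ∀ t s, tU < t → t < tW → sW < s → s < sU → col t ≠ colQ s) :
    0 < ((∑ i ∈ (Finset.Ico tU tW).image col, (v (P.1 i) i (P.2 i) - v (B.1 i) i (B.2 i)))
          - (if eP ∈ (Finset.Ico tU tW).image col then (∑ i, v (P.1 i) i (P.2 i)) - ∑ i, v (B.1 i) i (B.2 i) else 0))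
      + ((∑ i ∈ (Finset.Ico sW sU).image colQ, (v (Q.1 i) i (Q.2 i) - v (B.1 i) i (B.2 i)))
          - (if eQ ∈ (Finset.Ico sW sU).image colQ then (∑ i, v (Q.1 i) i (Q.2 i)) - ∑ i, v (B.1 i) i (B.2 i) else 0)) := by
  classical
  set A : Finset (Fin m) := (Finset.Ico tU tW).image col with hAdef
  set D : Finset (Fin m) := (Finset.Ico sW sU).image colQ with hDdef
  have memA : ∀ {i}, i ∈ A ↔ ∃ t, tU ≤ t ∧ t < tW ∧ col t = i := by
    intro i; simp only [hAdef, mem_image, mem_Ico]; exact ⟨fun ⟨t, ⟨h1, h2⟩, h3⟩ => ⟨t, h1, h2, h3⟩, fun ⟨t, h1, h2, h3⟩ => ⟨t, ⟨h1, h2⟩, h3⟩⟩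
  have memD : ∀ {i}, i ∈ D ↔ ∃ s, sW ≤ s ∧ s < sU ∧ colQ s = i := by
    intro i; simp only [hDdef, mem_image, mem_Ico]; exact ⟨fun ⟨t, ⟨h1, h2⟩, h3⟩ => ⟨t, h1, h2, h3⟩, fun ⟨t, h1, h2, h3⟩ => ⟨t, ⟨h1, h2⟩, h3⟩⟩
  -- the two runs are disjoint: a common column strictly inside contradicts the empty box, the corners are excluded by the coordinates
  have hAD : Disjoint A D := by
    rw [Finset.disjoint_left]
    intro i hiA hiD
    obtain ⟨t, ht1, ht2, rfl⟩ := memA.1 hiA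
    obtain ⟨s, hs1, hs2, hts⟩ := memD.1 hiD
    have hNP : 0 < NP := by omega
    have hNQ : 0 < NQ := by omega
    rcases Nat.lt_or_ge tU t with htU | htU
    · rcases Nat.lt_or_ge sW s with hsW | hsW
      · exact hbox t s htU ht2 hsW hs2 hts.symm
      · -- `s = sW`: the column is `W = col tW`
        have hs : s = sW := le_antisymm hsW hs1
        have h1 : col t = col tW := by rw [hW, ← hs]; exact hts.symm
        rcases Nat.lt_or_ge tW NP with htWNP | htWNP
        · have := hci t tW (by omega) htWNP h1; omega
        · have htW' : tW = NP := le_antisymm htW htWNP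
          rw [htW', hcN] at h1
          have := hci t 0 (by omega) hNP h1
          omega
    · -- `t = tU`: the column is `U = colQ sU`
      have ht : t = tU := le_antisymm htU ht1
      have h1 : colQ s = colQ sU := by rw [hts, ht, hU]
      rcases Nat.lt_or_ge sU NQ with hsUNQ | hsUNQ
      · have := hqi s sU (by omega) hsUNQ h1; omega
      · have hsU' : sU = NQ := le_antisymm hsU hsUNQ
        rw [hsU', hqN] at h1
        have hs0 : s = 0 := by have := hqi s 0 (by omega) hNQ h1; omega
        have hsW0 : sW = 0 := by omega
        have htU0 : tU = 0 := by
          have h2 : col tU = col 0 := by rw [hU, hsU', hqN, h00]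
          have := hci tU 0 (by omega) hNP h2; omega
        have htWNP : tW = NP := by
          by_contra hne
          have h2 : col tW = col 0 := by rw [hW, hsW0, h00]
          have := hci tW 0 (lt_of_le_of_ne htW hne) hNP h2
          omega
        exact hni ⟨htU0, htWNP⟩
  have htA : col tU ∈ A := memA.2 ⟨tU, le_rfl, htUW, rfl⟩
  have htD : colQ sW ∈ D := memD.2 ⟨sW, le_rfl, hsWU, rfl⟩
  have hinA : ∀ i ∈ A, i ≠ col (tW - 1) → B.1.symm (P.1 i) ∈ A ∧ B.1.symm (P.1 i) ≠ col tU := by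
    intro i hi hix
    obtain ⟨t, ht1, ht2, rfl⟩ := memA.1 hi
    have ht3 : t + 1 < tW := by
      by_contra h
      exact hix (by congr 1; omega)
    rw [hcs]
    refine ⟨memA.2 ⟨t + 1, by omega, ht3, rfl⟩, fun h => ?_⟩
    have := hci (t + 1) tU (by omega) (by omega) h
    omega
  have hinD : ∀ i ∈ D, i ≠ colQ (sU - 1) → B.1.symm (Q.1 i) ∈ D ∧ B.1.symm (Q.1 i) ≠ colQ sW := by
    intro i hi hix
    obtain ⟨s, hs1, hs2, rfl⟩ := memD.1 hi
    have hs3 : s + 1 < sU := by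
      by_contra h
      exact hix (by congr 1; omega)
    rw [hqs]
    refine ⟨memD.2 ⟨s + 1, by omega, hs3, rfl⟩, fun h => ?_⟩
    have := hqi (s + 1) sW (by omega) (by omega) h
    omega
  have hxA : B.1.symm (P.1 (col (tW - 1))) = colQ sW := by
    rw [hcs, ← hW]; congr 1; omega
  have hxD : B.1.symm (Q.1 (colQ (sU - 1))) = col tU := by
    rw [hqs, hU]; congr 1; omega
  -- the piece, by the docking lemma over `Bool` (`true` = the `P`-run)
  let PQ : Bool → Equiv.Perm (Fin m) × (Fin m → Fin K) := fun b => if b then P else Q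
  obtain ⟨T, hTin, hTout⟩ := Docking.docking (ι := Bool) B PQ (fun b => if b then A else D)
    (fun b => if b then col (tW - 1) else colQ (sU - 1)) (fun b => if b then col tU else colQ sW) (Equiv.swap true false)
    (by
      intro j j' hjj'
      cases j <;> cases j'
      · exact absurd rfl hjj'
      · simp only [Bool.false_eq_true, ↓reduceIte]; exact hAD.symm
      · simp only [Bool.false_eq_true, ↓reduceIte]; exact hAD
      · exact absurd rfl hjj')
    (by intro j; cases j <;> simp [htA, htD])
    (by
      intro j i hi hix
      cases j
      · simp only [Bool.false_eq_true, ↓reduceIte] at hi hix ⊢; exact hinD i hi hix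
      · simp only [↓reduceIte] at hi hix ⊢; exact hinA i hi hix)
    (by
      intro j; cases j
      · simp only [Bool.false_eq_true, ↓reduceIte, Equiv.swap_apply_right]; exact hxD
      · simp only [↓reduceIte, Equiv.swap_apply_left, Bool.false_eq_true]; exact hxA)
  have hTA : ∀ i ∈ A, T.1 i = P.1 i ∧ T.2 i = P.2 i := fun i hi => by simpa [PQ] using hTin true i (by simpa using hi)
  have hTD : ∀ i ∈ D, T.1 i = Q.1 i ∧ T.2 i = Q.2 i := fun i hi => by simpa [PQ] using hTin false i (by simpa using hi)
  have hTB : ∀ i, i ∉ A → i ∉ D → T.1 i = B.1 i ∧ T.2 i = B.2 i := fun i hA hD => hTout i (fun j => by cases j <;> simpa)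
  -- presence and non-degeneracy
  have hTpres : termSign ε T ≠ 0 := by
    rw [termSign_ne_zero_iff]
    intro i
    by_cases hiA : i ∈ A
    · rw [(hTA i hiA).1, (hTA i hiA).2]; exact (termSign_ne_zero_iff ε P).1 hP.1 i
    by_cases hiD : i ∈ D
    · rw [(hTD i hiD).1, (hTD i hiD).2]; exact (termSign_ne_zero_iff ε Q).1 hQ.1 i
    · rw [(hTB i hiA hiD).1, (hTB i hiA hiD).2]; exact (termSign_ne_zero_iff ε B).1 hB.1 i
  have hT_ne_B : T ≠ B := by
    intro h
    have := hcdev tU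
    exact this ⟨by rw [← (hTA _ htA).1, h], by rw [← (hTA _ htA).2, h]⟩
  have hT_ne_P : T ≠ P := by
    intro h
    have hWD : col tW ∈ D := hW ▸ htD
    exact hWstar ⟨by rw [← h, (hTD _ hWD).1], by rw [← h, (hTD _ hWD).2]⟩
  have hT_ne_Q : T ≠ Q := by
    intro h
    exact hUstar ⟨by rw [← (hTA _ htA).1, h], by rw [← (hTA _ htA).2, h]⟩
  -- slope of the piece
  have hsP := Docking.slope_eq_of_concentrated d B P eP hcP
  have hsQ := Docking.slope_eq_of_concentrated d B Q eQ hcQ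
  have slopeT : TropicalCensus.slope d T = TropicalCensus.slope d B
      + (if eP ∈ A then TropicalCensus.slope d P - TropicalCensus.slope d B else 0)
      + (if eQ ∈ D then TropicalCensus.slope d Q - TropicalCensus.slope d B else 0) := by
    have key : ∀ i ∈ (univ : Finset (Fin m)), ((d (T.2 i)) : ℤ) = (d (B.2 i) : ℤ)
        + (if i = eP ∧ eP ∈ A then ((d (P.2 eP)) : ℤ) - d (B.2 eP) else 0)
        + (if i = eQ ∧ eQ ∈ D then ((d (Q.2 eQ)) : ℤ) - d (B.2 eQ) else 0) := by
      intro i _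
      by_cases hiA : i ∈ A
      · have hiD : i ∉ D := disjoint_left.mp hAD hiA
        rw [(hTA i hiA).2, if_neg (fun h : i = eQ ∧ eQ ∈ D => hiD (h.1 ▸ h.2))]
        by_cases hie : i = eP
        · subst hie; rw [if_pos ⟨rfl, hiA⟩]; ring
        · rw [if_neg (fun h => hie h.1), hcP i hie]; ring
      by_cases hiD : i ∈ D
      · rw [(hTD i hiD).2, if_neg (fun h : i = eP ∧ eP ∈ A => hiA (h.1 ▸ h.2))]
        by_cases hie : i = eQ
        · subst hie; rw [if_pos ⟨rfl, hiD⟩]; ring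
        · rw [if_neg (fun h => hie h.1), hcQ i hie]; ring
      · rw [(hTB i hiA hiD).2, if_neg (fun h : i = eP ∧ eP ∈ A => hiA (h.1 ▸ h.2)),
          if_neg (fun h : i = eQ ∧ eQ ∈ D => hiD (h.1 ▸ h.2))]; ring
    unfold TropicalCensus.slope at *
    rw [sum_congr rfl key, sum_add_distrib, sum_add_distrib, sum_ite, sum_ite, sum_const_zero, sum_const_zero, add_zero, add_zero,
      sum_const, sum_const, nsmul_eq_mul, nsmul_eq_mul]
    have cP : ((univ.filter fun i => i = eP ∧ eP ∈ A).card : ℤ) = if eP ∈ A then 1 else 0 := by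
      by_cases h : eP ∈ A
      · rw [if_pos h]
        have : (univ.filter fun i => i = eP ∧ eP ∈ A) = {eP} := by ext i; simp [h]
        rw [this, card_singleton]; simp
      · rw [if_neg h]
        have : (univ.filter fun i => i = eP ∧ eP ∈ A) = ∅ := by ext i; simp [h]
        rw [this, card_empty]; simp
    have cQ : ((univ.filter fun i => i = eQ ∧ eQ ∈ D).card : ℤ) = if eQ ∈ D then 1 else 0 := by
      by_cases h : eQ ∈ D
      · rw [if_pos h]
        have : (univ.filter fun i => i = eQ ∧ eQ ∈ D) = {eQ} := by ext i; simp [h]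
        rw [this, card_singleton]; simp
      · rw [if_neg h]
        have : (univ.filter fun i => i = eQ ∧ eQ ∈ D) = ∅ := by ext i; simp [h]
        rw [this, card_empty]; simp
    rw [cP, cQ, hsP, hsQ]
    split_ifs <;> ring
  -- the re-assembly deficit for this one piece, tokens indexed by `Bool`
  have hPQdom : ∀ b, IsDominant d v ε ((fun b => if b then θP else θQ) b) (PQ b) := by
    intro b; cases b
    · simpa [PQ] using hQ
    · simpa [PQ] using hP
  have hδ : ∀ b, TropicalCensus.slope d B < TropicalCensus.slope d (PQ b) := by
    intro b; cases b
    · simp only [PQ, Bool.false_eq_true, ↓reduceIte]; exact slope_lt_of_concentrated d eQ hcQ hδQ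
    · simp only [PQ, ↓reduceIte]; exact slope_lt_of_concentrated d eP hcP hδP
  let J : Finset Bool := (if eP ∈ A then {true} else ∅) ∪ (if eQ ∈ D then {false} else ∅)
  have hsJ : TropicalCensus.slope d T =
      TropicalCensus.slope d B + ∑ j ∈ J, (TropicalCensus.slope d (PQ j) - TropicalCensus.slope d B) := by
    rw [slopeT]
    have : ∑ j ∈ J, (TropicalCensus.slope d (PQ j) - TropicalCensus.slope d B) =
        (if eP ∈ A then TropicalCensus.slope d P - TropicalCensus.slope d B else 0)
        + (if eQ ∈ D then TropicalCensus.slope d Q - TropicalCensus.slope d B else 0) := by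
      simp only [J]
      (by_cases h1 : eP ∈ A <;> by_cases h2 : eQ ∈ D <;> simp [h1, h2, PQ]); ring
    rw [this]; ring
  have key := Deficit.reassembly_deficit d v ε (fun b => if b then θP else θQ) PQ hB hPQdom hδ hTpres hT_ne_B
    (fun b => by cases b <;> simpa [PQ] using (by first | exact hT_ne_Q | exact hT_ne_P)) J hsJ
  -- the token side of the deficit
  have lhs : ∑ j ∈ J, ((∑ i, v ((PQ j).1 i) i ((PQ j).2 i)) - ∑ i, v (B.1 i) i (B.2 i)) =
      (if eP ∈ A then (∑ i, v (P.1 i) i (P.2 i)) - ∑ i, v (B.1 i) i (B.2 i) else 0)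
      + (if eQ ∈ D then (∑ i, v (Q.1 i) i (Q.2 i)) - ∑ i, v (B.1 i) i (B.2 i) else 0) := by
    simp only [J]
    (by_cases h1 : eP ∈ A <;> by_cases h2 : eQ ∈ D <;> simp [h1, h2, PQ]); ring
  -- the valuation side: the piece carries `P` on `A`, `Q` on `D`, `B` elsewhere
  have rhs : (∑ i, v (T.1 i) i (T.2 i)) - ∑ i, v (B.1 i) i (B.2 i) =
      (∑ i ∈ A, (v (P.1 i) i (P.2 i) - v (B.1 i) i (B.2 i))) + ∑ i ∈ D, (v (Q.1 i) i (Q.2 i) - v (B.1 i) i (B.2 i)) := by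
    rw [← sum_sub_distrib]
    have hpt : ∀ i ∈ (univ : Finset (Fin m)), v (T.1 i) i (T.2 i) - v (B.1 i) i (B.2 i) =
        (if i ∈ A then v (P.1 i) i (P.2 i) - v (B.1 i) i (B.2 i) else 0)
        + (if i ∈ D then v (Q.1 i) i (Q.2 i) - v (B.1 i) i (B.2 i) else 0) := by
      intro i _
      by_cases hiA : i ∈ A
      · have hiD : i ∉ D := disjoint_left.mp hAD hiA
        rw [(hTA i hiA).1, (hTA i hiA).2, if_pos hiA, if_neg hiD]; ring
      by_cases hiD : i ∈ D
      · rw [(hTD i hiD).1, (hTD i hiD).2, if_neg hiA, if_pos hiD]; ring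
      · rw [(hTB i hiA hiD).1, (hTB i hiA hiD).2, if_neg hiA, if_neg hiD]; ring
    rw [sum_congr rfl hpt, sum_add_distrib, sum_ite_mem, sum_ite_mem, univ_inter, univ_inter]
  rw [lhs, rhs] at key
  linarith

end Piece

end SingleContact

end Summit.ValiantsHypothesis.ValiantsHypothesis.Theorems.KPlusLogSqLaw
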